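import Summits.HodgeConjecture.HodgeConjecture.Cruxes.HLiu418.Lines.F0_P6a_PELWitnessEDefs   -- («M-L» β layering) the E-line DEFS module: `SigDatum`, `RecordSignatureDatumOfSystem`, `GSAdele`; the E-line proper `F0_P6a_PELWitnessE` imports THIS leaf and pays its socket `stub_SIG := F0P6aStubSIG.stub_SIG_of_line`
import Literature.NumberTheory.Automorphic.UnitaryGroupLevelBasis                        -- ★ `UnitaryGroup.exists_finCongruenceLevel_span_subset` (open levels contain `K_{U,f}(n)`)
import Literature.NumberTheory.Automorphic.UnitaryGroupArithmeticLevels                  -- ★ `arithmeticLevel_finCongruenceLevel_span`, `arithmeticLevel_mono`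
import Literature.AlgebraicGeometry.ShimuraVarieties.UnitaryShimuraCurveRecordSignature     -- ★ p847754 (LA5-p02): `RecordSystemGS.posDef_map_of_ne`, `…exists_sigDatum_one_of_forall_ne`, `…exists_conjTranspose_mul_map_mul_eq_signatureMatrix_one`
import Literature.AlgebraicGeometry.ShimuraVarieties.UnitaryShimuraCurveRecordDiscrete      -- ★ p847725 (LA5-p01): `RecordSystemGS.finite_setOf_mem_norm_le_of_le_arithmeticLevel` (DISC ∘ Γ-clause)
import Literature.NumberTheory.Automorphic.UnitaryGroupEllipticGeneratorBounded            -- ★ p847937 (LA5-p02): `infinite_setOf_mem_principalCongruenceSubgroup_norm_le_of_generator` (pays `stub_TAIL`)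
import Literature.NumberTheory.Automorphic.UnitaryGroupTwoIndefinitePlacesNotDiscrete      -- ★ p848039 (LA5-p01): `TwoIndefinitePlaces.exists_unitary_generator_elliptic_hyperbolic` (pays `stub_GEN`)
import Mathlib.NumberTheory.NumberField.CMField
import HarnessLib

/-!
# `stub_SIG` CLOSER LEAF `Lines/F0_P6a_StubSIG.lean` — ED. 2 candidate, «M-L» β layering: l. 1 imports the Defs module, junction by NAME of the letter (LA5-plan (g0), GO500 SEATPLAN §1A row L5; LEAD heir F0P6-plan (g3) L-DEAL v1 §L5, «M-60» (a)∕(d))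

Cell `hodgecm-mathlib`, crux hLiu418 (stmt-HodgeConjecture-24832), P6 «MOD», E-line `Lines/F0_P6a_PELWitnessE.lean` ED. 4 (sha16 2a1a8134c478add6),
socket `stub_SIG : RecordSignatureDatumOfSystem` (:389–:406; its TYPE is unchanged in ED. 5, A-p01 (g27) memo cab96777 §B).
HONEST LABEL: HC_CM is proved only modulo the 7 printed citations (2 remaining: hLiu418 = stmt-HodgeConjecture-24832, h413 = stmt-HodgeConjecture-24833)
until rung 0 closes; this HOME file is count-neutral (v4: no `sorry`; it re-derives the socket `stub_SIG`՚s statement from ★ tree theorems).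

THE MATHEMATICS (verdict of record: LEAD «M-42», F0P6-ref1 (g3) SIG-AUDIT 23:38:42Z, critic F0P5a-ref1 (g8) memo 963447b9).  Take `t := 1`.
With `L₁ := ℚ(J⋆ᵢⱼ) ⊆ F` and a piece `B := B q₀` of the record system at the small level `Kc` (`(B q₀).Hℂ = J⋆^{ι₁}`, field `pieces` of ★ `RecordSystemGS`):
* signature `(1,1)` AT `ι₁` is `(B q₀).signature_τ₁` (proved here, §2);
* case (2) — `σ` reads `J⋆` neither as `ι₁` nor as `ῑ₁` does (`J⋆^σ ∉ {J⋆^{ι₁}, J⋆^{ῑ₁}}`): `J⋆^σ` is positive definite, from `(B q₀).posDef_of_ne`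
  at an extension `τ′ : (B q₀).E → ℂ` of `σ ∘ ι₁⁻¹` — ORGAN `stub_POS2` (M; ★ p847754 `RecordSystemGS.posDef_map_of_ne`, PAID);
* case (3) — `mk σ ≠ mk ι₁` but `J⋆^σ ∈ {J⋆^{ι₁}, J⋆^{ῑ₁}}` (possible as a configuration iff `ℚ(J⋆ᵢⱼ) ⊉ F⁺`): then `J⋆^σ` has signature `(1,1)`
  and NO record system exists; the only field of the record that sees it is `pieces` through its Γ-CLAUSE
  `(B q₀).Γ.map (GL₂ τ₁) = Γ_{J⋆}(g Kc g⁻¹).map (GL₂ ι₁)`: the left side is PROPERLY DISCRETE in `τ₁`-absolute value (★ `UnitaryBallUniformisationDatum.finite_setOf_norm_τ₁_apply_le`: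
  a congruence subgroup of a form DEFINITE off the place of `τ₁` has finitely many elements of bounded `τ₁`-size; composed with the Γ-clause = ★ p847725
  `RecordSystemGS.finite_setOf_mem_norm_le_of_le_arithmeticLevel`, already at the level `Kc` itself), while the right side contains, for a principal level
  `Γ(n) ≤ Γ_{J⋆}(Kc)`, INFINITELY many elements of bounded `ι₁`-size as soon as `U(J⋆)` is indefinite at a SECOND place (irreducible-lattice class,
  [Raghunathan 1972] Cor. 5.21 ∕ [Margulis 1991] II.6.7(a); ELEMENTARY road in two organs: `stub_GEN` = one integral det-1 element of `U(J⋆)` elliptic at `ι₁`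
  and hyperbolic at `σ` (Dirichlet՚s unit theorem in a quadratic `F⁺`-subalgebra), `stub_TAIL` = its powers give infinitely many `ι₁`-bounded elements of
  every `Γ(n)` (Cayley–Hamilton)).  Contradiction, so case (3) is empty.

ORGANS — DEAL v2 (F0∕P6 bus «L5» 02:20:29Z; joint cut LA5-p01∕LA5-p02 02:16:47Z ratified); v3 = v2 with `stub_TAIL` PAID (★ p847937); v4 = v3 with
`stub_GEN` PAID (★ p848039) — v4 is SORRY-FREE (every organ ★; the head՚s axioms are the TRIO):
`stub_POS2 : SigPOS2` PAID in-line by ★ p847754 `RecordSystemGS.posDef_map_of_ne` (kept as a named organ, sorry-free); (O-DISC) RETIRED as an organ — ★ p847725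
`RecordSystemGS.finite_setOf_mem_norm_le_of_le_arithmeticLevel` (DISC ∘ Γ-clause, at `Γ := Γ_{J⋆}(n) ≤ Γ_{J⋆}(Kc)`) is consumed directly by the head;
(O-NDISC) is CUT IN TWO: `stub_GEN : SigGEN` → LA5-p01 (g0) («∃ an elliptic-at-`ι₁` ∕ hyperbolic-at-`σ` INTEGRAL det-1 element of `U(J)`», Dirichlet∕AdjoinRoot road;
PAID by ★ p848039 `TwoIndefinitePlaces.exists_unitary_generator_elliptic_hyperbolic`, one term)
and `stub_TAIL : SigTAIL` → LA5-p02 (g0) («one such generator ⇒ infinitely many `ι₁`-bounded elements of every `Γ_J(n)`», Cayley–Hamilton∕Chebyshev road;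
letter = ★ p847937 `infinite_setOf_mem_principalCongruenceSubgroup_norm_le_of_generator` TOKEN FOR TOKEN — PAID by that one term; sorries = {`stub_GEN`}).
HEAD `stub_SIG_of_organs : SigGEN → SigTAIL → RecordSignatureDatumOfSystem` PROVED (socket via ★ `exists_sigDatum_one_of_forall_ne`; case (3) by_contra:
frame ⇒ `det.re < 0` at `ι₁` and at `σ`, GEN, TAIL at a principal level `n` with `K_{U,f}(n) ⊆ Kc` (★ level basis), contradiction with ★ p847725);
`stub_SIG_of_line` = head ∘ organs (same statement as the socket: `example : type_of% @F0P6aPELWitnessE.stub_SIG := @stub_SIG_of_line`).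
-/

set_option autoImplicit false

noncomputable section

namespace Summit.HodgeConjecture.HodgeConjecture.Cruxes.HLiu418.F0P6aStubSIG

set_option linter.dupNamespace false  -- `Summit.HodgeConjecture.HodgeConjecture.…` BY DESIGN (D-0017)

open NumberField IsDedekindDomain MulAction Matrix
open scoped Matrix ComplexOrder
open Literature.AlgebraicGeometry.Motives (SchemeOver)
open Literature.AlgebraicGeometry.ShimuraVarieties Literature.AlgebraicGeometry.ShimuraVarieties.UnitaryCanonicalModel
open Literature.NumberTheory.Automorphic Literature.NumberTheory.Automorphic.UnitaryGroup Literature.NumberTheory.Automorphic.ShimuraDissection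
open Literature.NumberTheory.Automorphic.Liu2021.AppendixC (C5.OpenCompactSubgroup C5.SmallLevel)
open Summit.HodgeConjecture.HodgeConjecture.Cruxes.HLiu418.F0P6aPELWitnessE (GSAdele SigDatum RecordSignatureDatumOfSystem)

/-! ### §0 The organ letters (Props BY VALUE over ★ declarations) -/

/-- **(O-POS2) OFF-PLACE POSITIVITY IN CASE (2)** — for a record system `S` of `(F, ι₁, J⋆)` and a complex embedding `σ` reading `J⋆` neither as `ι₁`
nor as `ῑ₁` does, `J⋆^σ` is positive definite.  Road (SIG-AUDIT «M-42» (b)): a piece `B q` of `S.pieces Kc` is a ball datum with `(B q).Hℂ = J⋆^{ι₁}`, so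
`ι₁(ℚ(J⋆ᵢⱼ)) ⊆ (B q).E`; extend `σ ∘ ι₁⁻¹` to `τ′ : (B q).E →+* ℂ` (`IsAlgClosed.lift`); the two inequalities give `mk τ′ ≠ mk E.subtype`
(`InfinitePlace.mk_eq_iff`, `ComplexEmbedding.conjugate`), and `(B q).posDef_of_ne τ′` is `(J⋆^σ).PosDef` entrywise.  Size M.  Hand: LA5-p02 (g0).
[cite: Liu2021, App. C Rem. C.2 p. 108 (signature (n−1,1) at τ, (n,0) elsewhere)] [cite: BergeronMillsonMoeglin2016Balls, Part 2 §1.1] -/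
def SigPOS2 : Prop :=
  ∀ (F : Type) [Field F] [NumberField F] [IsCMField F] (ι₁ : F →+* ℂ) (Jstar : Matrix (Fin 2) (Fin 2) F)
    (K₀ : C5.OpenCompactSubgroup (GSAdele F Jstar)) (_S : RecordSystemGS F Jstar ι₁ K₀) (_Kc : C5.SmallLevel K₀) (σ : F →+* ℂ),
    Jstar.map σ ≠ Jstar.map ι₁ → Jstar.map σ ≠ Jstar.map (ComplexEmbedding.conjugate ι₁) → (Jstar.map σ).PosDef

/-- **(O-GEN) AN ELLIPTIC–HYPERBOLIC INTEGRAL GENERATOR** (head half of NOREC-A; hand LA5-p01 (g0)) — `J` hermitian `2 × 2` over the CM field `F`,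
INDEFINITE at `ι₁` and at `σ` (for `2 × 2` hermitian: indefinite ⟺ `det < 0`), `σ` off the place of `ι₁`: there is `g ∈ U(J)` with INTEGRAL entries,
`det g = 1`, `c`-fixed trace, `|ι₁ (tr g)| < 2` (elliptic at `ι₁`: unimodular non-real eigenvalues) and `|σ (tr g)| > 2` (hyperbolic at `σ`).  Road
(LA5-p01 02:02:58Z∕02:07:51Z): in the `F⁺`-algebra `B_J = {X ∈ M₂(F) ∣ J⁻¹X*J = adj X}` an integral `X₀` with discriminant `tr² − 4 det` negative at
`ι₁|F⁺` and positive at `σ|F⁺`; `K := F⁺[X₀]` (AdjoinRoot) is complex over `ι₁|F⁺`, real over `σ|F⁺`; Dirichlet (`NumberField.Units.dirichletUnitTheorem.exists_unit`)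
gives a unit `ε` small at every place but the real one over `σ`; a power of `x := ε ∕ ε̄` in the order `𝓞_{F⁺}[X₀]` is the generator.
[cite: PlatonovRapinchuk1994, §4.1 and §5.1] [cite: BergeronMillsonMoeglin2016Balls, Introduction §1.1] -/
def SigGEN : Prop :=
  ∀ (F : Type) [Field F] [NumberField F] [IsCMField F] (ι₁ σ : F →+* ℂ) (J : Matrix (Fin 2) (Fin 2) F),
    (J.map (IsCMField.complexConj F))ᵀ = J → (J.map ι₁).det.re < 0 → (J.map σ).det.re < 0 →
    InfinitePlace.mk σ ≠ InfinitePlace.mk ι₁ →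
    ∃ (g : GL (Fin 2) F) (G : Matrix (Fin 2) (Fin 2) (𝓞 F)),
      g ∈ unitaryGroup ((IsCMField.complexConj F : F ≃ₐ[↥(maximalRealSubfield F)] F) : F →+* F) J ∧
      G.map (algebraMap (𝓞 F) F) = (g : Matrix (Fin 2) (Fin 2) F) ∧
      (g : Matrix (Fin 2) (Fin 2) F).det = 1 ∧
      IsCMField.complexConj F (g : Matrix (Fin 2) (Fin 2) F).trace = (g : Matrix (Fin 2) (Fin 2) F).trace ∧
      ‖ι₁ (g : Matrix (Fin 2) (Fin 2) F).trace‖ < 2 ∧ 2 < ‖σ (g : Matrix (Fin 2) (Fin 2) F).trace‖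

/-- **(O-TAIL) ONE ELLIPTIC–HYPERBOLIC GENERATOR GIVES INFINITELY MANY `ι₁`-BOUNDED ELEMENTS OF EVERY `Γ_J(n)`** (tail half of NOREC-A; hand
LA5-p02 (g0); = its letter `infinite_setOf_mem_principalCongruenceSubgroup_norm_le_of_generator`, statement-first GREEN 026b2b9d, as a ∀-Prop with the
same binder ORDER).  Road (LA5-p02 02:16:47Z): Cayley–Hamilton `g² = t·g − 1`, `g^k = u_k g − u_{k−1}`, Chebyshev recurrence; at `ι₁` (`|ι₁ t| < 2`) the
form `u² − s u v + v²` is invariant ⇒ `|u_k| ≤ 2∕√(4 − s²)` ⇒ bounded entries; at `σ` (`|σ t| > 2`) `k ↦ g^k` is injective; `𝓞 F ⧸ (n)` finite ⇒ a power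
`g^{o}` is `≡ 1 mod n` integrally together with its inverse ⇒ `{g^{ko}}_k ⊆ Γ_J(n)` infinite.  [folklore] [cite: PlatonovRapinchuk1994, §4.1] -/
def SigTAIL : Prop :=
  ∀ (F : Type) [Field F] [NumberField F] [IsCMField F] (ι₁ σ : F →+* ℂ) (J : Matrix (Fin 2) (Fin 2) F) (g : GL (Fin 2) F)
    (_hgU : g ∈ unitaryGroup ((IsCMField.complexConj F : F ≃ₐ[↥(maximalRealSubfield F)] F) : F →+* F) J)
    (G : Matrix (Fin 2) (Fin 2) (𝓞 F)) (_hG : G.map (algebraMap (𝓞 F) F) = (g : Matrix (Fin 2) (Fin 2) F))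
    (_hdet : (g : Matrix (Fin 2) (Fin 2) F).det = 1)
    (_htr : IsCMField.complexConj F (g : Matrix (Fin 2) (Fin 2) F).trace = (g : Matrix (Fin 2) (Fin 2) F).trace)
    (_hell : ‖ι₁ (g : Matrix (Fin 2) (Fin 2) F).trace‖ < 2) (_hhyp : 2 < ‖σ (g : Matrix (Fin 2) (Fin 2) F).trace‖) {n : ℕ} (_hn : n ≠ 0),
    ∃ C : ℝ, {γ : GL (Fin 2) F |
      γ ∈ principalCongruenceSubgroup ((IsCMField.complexConj F : F ≃ₐ[↥(maximalRealSubfield F)] F) : F →+* F) J n ∧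
        ∀ i j, ‖ι₁ ((γ : Matrix (Fin 2) (Fin 2) F) i j)‖ ≤ C}.Infinite

/-! ### §1 The registered organs (all PAID by ★ tree theorems, one term each; no `sorry` left) -/

/-- ORGAN (O-POS2), see `SigPOS2` — PAID by ★ p847754 `RecordSystemGS.posDef_map_of_ne` (LA5-p02 (g0)). [cite: Liu2021, App. C Rem. C.2 p. 108] -/
theorem stub_POS2 : SigPOS2 := fun _F _ _ _ _ι₁ _Jstar _K₀ S Kc σ h₁ h₂ => S.posDef_map_of_ne Kc σ h₁ h₂

/-- ORGAN (O-GEN), see `SigGEN` — PAID by ★ p848039 `TwoIndefinitePlaces.exists_unitary_generator_elliptic_hyperbolic` (LA5-p01 (g0)), ONE TERM.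
[cite: PlatonovRapinchuk1994, §4.1 and §5.1] -/
theorem stub_GEN : SigGEN := TwoIndefinitePlaces.exists_unitary_generator_elliptic_hyperbolic

/-- ORGAN (O-TAIL), see `SigTAIL` — PAID by ★ p847937 `infinite_setOf_mem_principalCongruenceSubgroup_norm_le_of_generator` (LA5-p02 (g0)), ONE TERM.
[cite: PlatonovRapinchuk1994, §4.1] -/
theorem stub_TAIL : SigTAIL := infinite_setOf_mem_principalCongruenceSubgroup_norm_le_of_generator

/-! ### §2 Glue (sorry-free) -/

/-- The signature matrix is real: entrywise complex conjugation fixes it. [folklore] -/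
private theorem signatureMatrix_map_conj (p : ℕ) : (signatureMatrix p).map (starRingEnd ℂ) = signatureMatrix p := by
  ext i j
  simp only [signatureMatrix, Matrix.map_apply, Matrix.diagonal_apply]
  split_ifs <;> simp

/-- Conjugating a frame: if `J` has signature `(1,1)` in the frame `T`, then `J̄` (entrywise conjugate) has signature `(1,1)` in the frame `T̄`. [folklore] -/
private theorem exists_frame_conj {J : Matrix (Fin 2) (Fin 2) ℂ}
    (h : ∃ T : GL (Fin 2) ℂ, (T : Matrix (Fin 2) (Fin 2) ℂ)ᴴ * J * (T : Matrix (Fin 2) (Fin 2) ℂ) = signatureMatrix 1) :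
    ∃ T : GL (Fin 2) ℂ, (T : Matrix (Fin 2) (Fin 2) ℂ)ᴴ * J.map (starRingEnd ℂ) * (T : Matrix (Fin 2) (Fin 2) ℂ) = signatureMatrix 1 := by
  obtain ⟨T, hT⟩ := h
  refine ⟨Matrix.GeneralLinearGroup.map (starRingEnd ℂ) T, ?_⟩
  have hc : ((Matrix.GeneralLinearGroup.map (starRingEnd ℂ) T : GL (Fin 2) ℂ) : Matrix (Fin 2) (Fin 2) ℂ) =
      (T : Matrix (Fin 2) (Fin 2) ℂ).map (starRingEnd ℂ) := by
    ext i j; simp [Matrix.GeneralLinearGroup.map_apply]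
  have hct : ((T : Matrix (Fin 2) (Fin 2) ℂ).map (starRingEnd ℂ))ᴴ = ((T : Matrix (Fin 2) (Fin 2) ℂ)ᴴ).map (starRingEnd ℂ) := by
    ext i j; simp [Matrix.conjTranspose_apply, Matrix.map_apply]
  rw [hc, hct, ← Matrix.map_mul, ← Matrix.map_mul, hT, signatureMatrix_map_conj]

/-- `J⋆^{ῑ₁}` is the entrywise conjugate of `J⋆^{ι₁}`. [folklore] -/
private theorem map_conjugate_eq {F : Type} [Field F] (ι : F →+* ℂ) (J : Matrix (Fin 2) (Fin 2) F) :
    J.map (ComplexEmbedding.conjugate ι) = (J.map ι).map (starRingEnd ℂ) := by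
  ext i j
  simp [Matrix.map_apply, ComplexEmbedding.conjugate_coe_eq]

/-- `det H_{1,1} = -1`. [folklore] -/
private theorem det_signatureMatrix_one : (signatureMatrix 1).det = -1 := by
  simp [signatureMatrix, Matrix.det_diagonal, Fin.prod_univ_two, Fin.ext_iff]

/-- A `2 × 2` matrix congruent to `H_{1,1}` has NEGATIVE REAL determinant: `det (Tᴴ J T) = |det T|² · det J = −1`. [folklore] -/
private theorem det_re_neg_of_frame {J : Matrix (Fin 2) (Fin 2) ℂ}
    (h : ∃ T : GL (Fin 2) ℂ, (T : Matrix (Fin 2) (Fin 2) ℂ)ᴴ * J * (T : Matrix (Fin 2) (Fin 2) ℂ) = signatureMatrix 1) : J.det.re < 0 := by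
  obtain ⟨T, hT⟩ := h
  have hdet := congrArg Matrix.det hT
  rw [Matrix.det_mul, Matrix.det_mul, Matrix.det_conjTranspose, det_signatureMatrix_one] at hdet
  set d : ℂ := (T : Matrix (Fin 2) (Fin 2) ℂ).det with hd
  have hd0 : d ≠ 0 := by
    intro h0
    rw [h0] at hdet
    norm_num at hdet
  have hprod : star d * J.det * d = J.det * (Complex.normSq d : ℂ) := by
    rw [← Complex.mul_conj, mul_comm (star d), mul_assoc, mul_comm (star d) d]
    rfl
  have hre : J.det.re * Complex.normSq d = -1 := by
    have := congrArg Complex.re (hprod.symm.trans hdet)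
    simpa [Complex.mul_re] using this
  nlinarith [Complex.normSq_pos.mpr hd0]

/-! ### §3 The head -/

set_option maxHeartbeats 400000 in
/-- **HEAD — `stub_SIG` from the organs** (`t := 1` via ★ `exists_sigDatum_one_of_forall_ne`, whose residual hypothesis is exactly «case (3) is empty»;
case (3) emptied by (O-GEN) + (O-TAIL) at a principal level `n` with `K_{U,f}(n) ⊆ Kc` (★ `exists_finCongruenceLevel_span_subset`) against ★ p847725
`finite_setOf_mem_norm_le_of_le_arithmeticLevel`).  Sorry-free.  [cite: Liu2021, App. C Rem. C.2 p. 108] [cite: BergeronMillsonMoeglin2016Balls, Introduction §1.1] -/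
theorem stub_SIG_of_organs (hGEN : SigGEN) (hTAIL : SigTAIL) : RecordSignatureDatumOfSystem := by
  intro F _ _ _ _ ι₁ Jstar hJ _hJu K₀ S Kc
  refine S.exists_sigDatum_one_of_forall_ne Kc fun σ hσ => ?_
  by_contra hcase
  -- (1,1) at `ι₁` (★ p847754) and, in case (3), at `σ`
  have h11 : ∃ T : GL (Fin 2) ℂ, (T : Matrix (Fin 2) (Fin 2) ℂ)ᴴ * Jstar.map ι₁ * (T : Matrix (Fin 2) (Fin 2) ℂ) = signatureMatrix 1 :=
    S.exists_conjTranspose_mul_map_mul_eq_signatureMatrix_one Kc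
  have h11σ : ∃ T : GL (Fin 2) ℂ, (T : Matrix (Fin 2) (Fin 2) ℂ)ᴴ * Jstar.map σ * (T : Matrix (Fin 2) (Fin 2) ℂ) = signatureMatrix 1 := by
    rcases not_and_or.mp hcase with h | h <;> push Not at h
    · rw [h]; exact h11
    · rw [h, map_conjugate_eq]; exact exists_frame_conj h11
  have hd₁ : (Jstar.map ι₁).det.re < 0 := det_re_neg_of_frame h11
  have hdσ : (Jstar.map σ).det.re < 0 := det_re_neg_of_frame h11σ
  -- a principal level inside the small level `Kc`
  obtain ⟨n, hn, hKn⟩ := exists_finCongruenceLevel_span_subset (F := ↥(maximalRealSubfield F)) (E := F)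
    (c := IsCMField.complexConj F) (N := 2) (J := Jstar) (U := (Kc.1.1 : Set (GSAdele F Jstar))) (Kc.1.2.1.mem_nhds (one_mem _))
  have hle : principalCongruenceSubgroup ((IsCMField.complexConj F : F ≃ₐ[↥(maximalRealSubfield F)] F) : F →+* F) Jstar n ≤
      arithmeticLevel ↥(maximalRealSubfield F) F (IsCMField.complexConj F) 2 Jstar Kc.1.1 := by
    rw [← arithmeticLevel_finCongruenceLevel_span hn]
    exact arithmeticLevel_mono fun x hx => hKn hx
  -- (O-GEN) + (O-TAIL): infinitely many `ι₁`-bounded elements of `Γ(n)`; ★ p847725: finitely many — contradiction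
  obtain ⟨g, G, hgU, hG, hdet, htr, hell, hhyp⟩ := hGEN F ι₁ σ Jstar hJ hd₁ hdσ hσ
  obtain ⟨C, hinf⟩ := hTAIL F ι₁ σ Jstar g hgU G hG hdet htr hell hhyp hn
  exact hinf (S.finite_setOf_mem_norm_le_of_le_arithmeticLevel Kc hle C)

/-- **`stub_SIG` BY THE LINE**: the socket՚s statement from the organs. [cite: Liu2021, App. C Rem. C.2 p. 108] -/
theorem stub_SIG_of_line : RecordSignatureDatumOfSystem :=
  stub_SIG_of_organs stub_GEN stub_TAIL

/-- SAME-STATEMENT TIE, β form: the letter `RecordSignatureDatumOfSystem` lives in the Defs module (FQN unchanged); the E-line ED. 5β pays its registered socket by `theorem stub_SIG : RecordSignatureDatumOfSystem := F0P6aStubSIG.stub_SIG_of_line` (the ED. 1 junction `type_of% @…F0P6aPELWitnessE.stub_SIG` would be an import cycle under β). -/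
example : Summit.HodgeConjecture.HodgeConjecture.Cruxes.HLiu418.F0P6aPELWitnessE.RecordSignatureDatumOfSystem := stub_SIG_of_line

end Summit.HodgeConjecture.HodgeConjecture.Cruxes.HLiu418.F0P6aStubSIG

end
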